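import Literature.MathematicalPhysics.QuantumFieldTheory.Balaban1983to89.B14Ineq319Proof
import Literature.MathematicalPhysics.QuantumFieldTheory.Balaban1983to89.B15Ineq142Proof

/-!
# `Balaban1983to89.B14Ineq319From190` — T. Bałaban, *Convergent renormalization expansions for lattice gauge theories*,
# Commun. Math. Phys. **119** (1988) 243–285 [Balaban1988Convergent] = [III], (3.18)–(3.19) p. 268: the bound
# *"the function 𝐇_{k+1,□′} is bounded by B₃exp(−δLM₂R_{k+1})44d²B₃ε_{k+1} ≦ 44d²B₃²(1+β₀)exp(−R_k)ε_k on □′^{∼2}"* DERIVED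
# from the exponential decay property (190) of [15] = [Balaban1985Variational] (one localised piece), the flow inequality
# (2.8) `ε_{k+1} ≤ (1+β₀)ε_k` and the radii inequality (2.9) `R_k ≤ L(1 + g²_{k+1}β′)^{β₀}R_{k+1}` p. 256, and (3.19)
# END-TO-END on p29's lattice model (`B14Ineq319Proof.ineq319_lt_local` with its hypothesis `h318` DISCHARGED)

statement-level skeleton of published theorems with citation tags; proofs where landed; nothing here is a claim
about the Yang–Mills mass gap

CITATION HEADER (lean-in-tree rule 2026-08-18).  T. Bałaban, *Convergent renormalization expansions for lattice gauge
theories*, Commun. Math. Phys. **119**, 243–285 (1988), doi:10.1007/BF01217741, bib `Balaban1988Convergent` (cell paper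
B14 = "[III]").  PDF held: `paper:balaban1988-cmp119-convergent-renormalization` (journal page = PDF page + 242), p. 268
[PDF 26] READ AS AN IMAGE on the x2 render
`run/shared/lean/pub/pub-balaban/b2b-balaban-ref1/pages/1988-cmp119-convergent-renormalization/…-p026-x2.png`, p. 256 [PDF 14]
((2.8)–(2.9), tree `B14.FlowIneq28` / `B14FlowStep.FlowIneq29`) (this seat, 2026-08-21).  "[15]" = T. Bałaban, CMP **102**
(1985) 277–309 [Balaban1985Variational], (190) p. 308 (tree: `B11SectG.Ineq190 bB bout dH C δ₀`); "[3]" of [15] =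
[Balaban1984PropagatorsII] (2.61) p. 234 (`B11SectG.RowSum`); "[12]" = [Balaban1985Averaging] (106)–(108), (159)–(166)
(`B7Eq162General`, `B7Eq84Concrete.glev`, used inside p29's file).

WHAT IS REPRODUCED.  SKELETON row **B14.Eq3.16–3.19** (members (3.18) bound and (3.19); rows of record
`lit-balaban-r11/ROWS-B14.md`: «(3.18) ∣H_{k+1,□′}∣ ≤ B₃exp(−δLM₂R_{k+1})44d²B₃ε_{k+1} ≤ 44d²B₃²(1+β₀)exp(−R_k)ε_k on □′^{~2} …
the (3.18)-bound on 𝐇_{k+1,□′} ([12] (106)–(108), (159)–(163)): r07's rows»; p29's `B14Ineq319Proof` (M4): «(3.18)'s … bound on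
`𝐇_{k+1,□′}` … and the flow `ε_{j+1} ≤ (1+β₀)ε_j` are HYPOTHESES»), mega-formalization `lit-balaban`, HOME
`run/shared/lean/pub/lit-balaban/`, unit `lit-balaban-r11` gen 7 (reader/typer and fold owner of block B14).  KNITTING — used BY
NAME, nothing restated: r12's `B15HDecayLeaves.loc_le_of_meanValue` (one localised piece through (190), mean-value reading of
Prop. 9 of [15]), r12's `B15GammaSmallness.exp_neg_R_le_gamma_sq` (`e^{−R_j} ≤ γ²` from (2.5)), r11's `B14FlowStep.FlowIneq29`
((2.9) typed), p29's `B14Ineq319Proof.ineq319_lt_local` ((3.19) in the lattice model from (3.18)'s bound on `B^k(b₋) ∪ B^k(b₊)`).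
Pattern = r12's `B15Ineq142Proof.boundH141_of_ineq190` + `B15Ineq142From190` ([IV] (1.42), the twin display).

THE PRINTED TEXT (p. 268, verbatim from the render): *"This follows from the identity analogous to (3.6), U_{k+1} =
U(𝐁_{k+1}(□′^{∼4}), [M˙(U_{k+1})(M˙(Q^{s*}_{k+1}V_{k+1}))⁻¹]M˙(Q^{s*}_{k+1}V_{k+1})) = (exp iL⁻¹η𝐇_{k+1,□′}((1/i) log[M˙(U_{k+1})
(M˙(Q^{s*}_{k+1}V_{k+1}))⁻¹]) U_{k+1,□′})^{u⁻¹_{k+1,□′}}. (3.17)  The field U_{k+1} satisfies the regularity condition |∂U_{k+1} − 1|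
< 2B₃ε_{k+1}(L⁻¹η)² on Ω_{k+1}, hence the argument of the function 𝐇_{k+1,□} is bounded by 44d²B₃ε_{k+1}, and has a support in
a boundary layer of the width 2LM₁ at the boundary of □′^{∼4}. Thus, the function 𝐇_{k+1,□′} is bounded by
B₃exp(−δLM₂R_{k+1})44d²B₃ε_{k+1} ≦ 44d²B₃²(1+β₀)exp(−R_k)ε_k on □′^{∼2}, and V^{(k)}(b) = u⁻¹_{k+1,□′}(b₋) exp iQ̃_k(L⁻¹η𝐇_{k+1,□′})
R̄^k u_{k+1,□′}(b₊) V^{(k)}_{□′}(b). (3.18)  These facts, and the bounds (106)–(108), (159)–(163) in [12], imply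
|V^{(k)}(b)(V^{(k)}_{□′}(b))⁻¹ − 1| < O(1)44d²B₃²(1+β₀)ε_k exp(−R_k) = O(1)44d²B₃²(1+β₀)(A₀/A₁)exp(−R_k)δ_k < δ_k (3.19)"*.
p. 256: *"ε_n ≦ (1+β₀)(n−m)^{1/2}ε_m, … (2.8)  R_n ≦ LR_m, R_m ≦ L(1 + g_n²β′(n−m))^{β₀}R_n ≦ (L+1)(n−m)^{β₀}R_n. (2.9)"*.

WHAT THIS FILE PROVES (kernel-checked, zero `sorry`; no `def`, no new `Prop`, no new named fact; axioms standard).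
Over the block-majorant vocabulary of `B11SectG` (`g : B6.Geometry`, `bB` = the B-size of the argument field, `bout` = a
local size of the values of `𝐇_{k+1,□′}`):
* §1 **(3.18), FIRST INEQUALITY FROM (190)** `boundH318_of_ineq190`: (190) at every base point, (2.61) at rate `σ`, `τ ≥ 0`
  with `σ + τ ≤ ⅛δ₀`, the argument field `B` of B-size `≤ 44d²B₃ε_{k+1}` (*"bounded by 44d²B₃ε_{k+1}"*) vanishing on the blocks
  `y′` with `d(y, y′) < D` (*"has a support in a boundary layer of the width 2LM₁ at the boundary of □′^{∼4}"*, seen from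
  `□′^{∼2}`) with `δLM₂R_{k+1} ≤ τD`, `Cκ_Bc ≤ B₃`, mean-value domination ⇒ `bout.loc y 𝐇B ≤ B₃e^{−δLM₂R_{k+1}}44d²B₃ε_{k+1}`.
  **(3.18), SECOND INEQUALITY** `boundH318_second`: `B₃e^{−δLM₂R_{k+1}}44d²B₃ε_{k+1} ≤ 44d²B₃²(1+β₀)e^{−R_k}ε_k` from (2.8)
  `ε_{k+1} ≤ (1+β₀)ε_k` (`ε_{k+1} ≥ 0`) and `R_k ≤ δLM₂R_{k+1}`; the latter FROM (2.9) `R_le_of_flowIneq29`: `R_k ≤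
  L(1 + g²_{k+1}β′)^{β₀}R_{k+1}` (`B14FlowStep.FlowIneq29` at `(m, n) = (k, k+1)`) and the clause `(1 + g²_{k+1}β′)^{β₀} ≤ δM₂` (what
  *"M₂ sufficiently large"* has to supply here).
* §2 **(3.19) END-TO-END ON THE LATTICE MODEL** `ineq319_lt_lattice_of_ineq190` — p29's
  `|M^k((e^{iL^{−(k+1)}𝐇}U₀)^{u⁻¹})(b)·M^k(U₀)(b)⁻¹ − 1| < δ_k` (`U₀ = U_{k+1,□′}`, `𝐇 = 𝐇_{k+1,□′}`, `u = glev`) with the hypothesis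
  `h318` of `B14Ineq319Proof.ineq319_lt_local` (the bound `44d²B₃²(1+β₀)e^{−R_k}ε_k` on `𝐇` over `B^k(b₋) ∪ B^k(b₊)`) NOT assumed
  but DERIVED: §1 for the block size `bout` at the base point `y`, and ONE dictionary hypothesis `hdom` (that size dominates
  `‖𝐇(y′, μ)‖` at the sites `y′` of `B^k(b₋) ∪ B^k(b₊)`); p29's located side conditions verbatim.  **FROM γ**
  `hgk_of_gamma` (the restriction `(68(d+1)+160d)·44d²B₃²(1+β₀)(A₀/A₁)e^{−R_k} < 1` of r11's `B14Sect3.ineq319_scalar` from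
  `e^{−R_k} ≤ γ²` and the clause `(68(d+1)+160d)·44d²B₃²(1+β₀)(A₀/A₁)γ² < 1`), `located319_of_gamma` (p29's four located
  `s`-conditions on `X = 44d²B₃²(1+β₀)e^{−R_k}ε_k` from `X ≤ 44d²B₃²(1+β₀)γ²`, `ε_k ≤ 1`, `d ≥ 1` and three explicit clauses in γ
  and the (52)-parameter `α₀`), `ineq319_lt_lattice_of_ineq190_gamma` (everything assembled: (190) data, dictionary, (2.8),
  `R_k ≤ δLM₂R_{k+1}`, γ-clauses ⇒ `< δ_k`).
* §3 (v1.2) **(2.8) BY NAME** `eps_succ_le_of_flowIneq28`: the flow letter `ε_{k+1} ≤ (1+β₀)ε_k` of §1/§2 IS the first member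
  of r11's typed (2.8) `B14.FlowIneq28 ε g β′ β₀ K` (`B14.lean`) at `(m, n) = (k, k+1)` (`(n−m)^{1/2} = 1`; sign-free in β);
  `boundH318_second_byname` = the second "≦" of (3.18) with (2.8) AND (2.9) taken by name (`B14.FlowIneq28`,
  `B14FlowStep.FlowIneq29`, the clause `(1 + g²_{k+1}β′)^{β₀} ≤ δM₂`); `ineq319_lt_lattice_of_ineq190_gamma_byname` = §2's
  assembled (3.19) with the letters `hflow` / `hRR` DERIVED from the typed rows (2.8) / (2.9) at the step `k → k+1 ≤ K` — so
  that row B14.Eq3.16–3.19 rests on the typed rows (2.5), (2.8), (2.9) of [III] BY NAME (the owner reading of record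
  `run/shared/lean/pub/lit-balaban/lit-balaban-r11/OWNER-READINGS-B14-g92.md`, case (a) by name).
HONEST SCOPE.  (190) itself ((2.61), the identification of print's sup over `□′^{∼2}` with the local size `bout`), the B-size
bound `44d²B₃ε_{k+1}` of the argument field (consequence of the regularity condition `|∂U_{k+1} − 1| < 2B₃ε_{k+1}(L⁻¹η)²` through
the `(1/i)log` chart — the p. 268 sentence, a cited METHOD as in `B15HDecayLeaves`) and its localisation distance `D` with
`δLM₂R_{k+1} ≤ τD` are HYPOTHESES in the printed shapes; `hmv` is the declared mean-value reading of Prop. 9 of [15]; the lattice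
model of §2 is p29's ((M1)–(M4) of `B14Ineq319Proof`: the `ℤ^d` carriers of [12]/[14] — `B7Prop2Explicit` dictionary,
values in a complete normed `ℂ`-algebra `𝔸` with `‖1‖ = 1` (a `NormedRing`, NOT assumed commutative), gauge group an
averaging-closed `G ⊂ U1` —, gauge fixing `glev`, (52)-type input `pdev U₀ < α₀L^{−2k}`).  Value = the (3.18) leaf of row
B14.Eq3.16–3.19 reduced to ONE typed published inequality ((190)) plus (2.8)/(2.9) and located data, and (3.19) with no
`𝐇`-hypothesis left, kernel-checked; NOT summit progress.
VERSIONS.  v1 = p262948 (commit 67a22959bee8).  v1.1 (p263533) is DOC-ONLY: the HONEST SCOPE sentence on the lattice model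
said «commutative-`𝔸` carriers» (wording inherited from `B15Ineq142From190`); corrected to the general normed-algebra carriers
that `B14Ineq319Proof`/`B15Ineq137Proof` (M1) actually use.  No declaration, statement or proof is changed.  v1.2 (this
file; unit `lit-balaban-r11` gen 94) APPENDS §3 (three theorems; (2.8)/(2.9) by name); §1/§2 are byte-identical to v1.1.
-/

open NormedSpace Finset

namespace Literature.MathematicalPhysics.QuantumFieldTheory.Balaban1983to89.B14Ineq319From190

open Literature.MathematicalPhysics.QuantumFieldTheory.Balaban1983to89
open B7Prop1Explicit B7Prop2Explicit B7Prop3Flat B7Eq92Concrete B7Eq162General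
open B11SectG B15HDecayLeaves B15GammaSmallness B14Ineq319Proof

variable {g : B6.Geometry} {FB FA : Type} [AddCommGroup FB] [Module ℝ FB] [AddCommGroup FA] [Module ℝ FA]

/-! ## §1 [III] (3.18) from (190), (2.8) and (2.9) -/

/-- **(3.18), FIRST INEQUALITY, p. 268 FROM (190)**: *"Thus, the function 𝐇_{k+1,□′} is bounded by
B₃exp(−δLM₂R_{k+1})44d²B₃ε_{k+1} … on □′^{∼2}"* for any local size `bout` of `𝐇_{k+1,□′}` from: (190) at every base point,
(2.61) at rate `σ`, `τ ≥ 0` with `σ + τ ≤ ⅛δ₀`, the argument field `B` of B-size `≤ 44d²B₃ε_{k+1}` (*"bounded by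
44d²B₃ε_{k+1}"*) vanishing on the blocks `y′` with `d(y, y′) < D` (the `2LM₁`-layer at `∂□′^{∼4}` seen from `□′^{∼2}`), the
geometry `δLM₂R_{k+1} ≤ τD`, `Cκ_Bc ≤ B₃`, and the mean-value domination (`R1 = R_{k+1}`).
[cite: Balaban1988Convergent, (3.18) p.268; Balaban1985Variational, (190) p.308] -/
theorem boundH318_of_ineq190 {T : Type*} {bB : BlockNorm g FB} {bout : BlockNorm g FA}
    {dH : T → FB →ₗ[ℝ] FA} {C δ₀ σ τ c D B₃ δ L M₂ R1 d εk1 : ℝ}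
    (h190 : ∀ t, Ineq190 bB bout (dH t) C δ₀) (hC : 0 ≤ C) (hd : ∀ a b : g.Site, 0 ≤ g.dist a b)
    (hrow : RowSum g σ c) (hτ : 0 ≤ τ) (hστ : σ + τ ≤ δ₀ / 8) (B : FB) (y : g.Site)
    (hm : ∀ y', bB.loc y' B ≤ 44 * d ^ 2 * B₃ * εk1) (hD : ∀ y', bB.loc y' B ≠ 0 → D ≤ g.dist y y')
    {HB : FA} (hmv : ∀ s : ℝ, (∀ t, bout.loc y (dH t B) ≤ s) → bout.loc y HB ≤ s)
    (hgeom : δ * L * M₂ * R1 ≤ τ * D) (hCB : C * bB.κ * c ≤ B₃) (hB₃ : 0 ≤ B₃) :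
    bout.loc y HB ≤ B₃ * Real.exp (-(δ * L * M₂ * R1)) * (44 * d ^ 2 * B₃) * εk1 := by
  have h := loc_le_of_meanValue h190 hC hd hrow hτ hστ B hm y hD hmv
  have hm0 : 0 ≤ 44 * d ^ 2 * B₃ * εk1 := (bB.loc_nonneg y B).trans (hm y)
  have hexp : Real.exp (-(τ * D)) ≤ Real.exp (-(δ * L * M₂ * R1)) := Real.exp_le_exp.mpr (by linarith)
  have h2 : C * bB.κ * c * (44 * d ^ 2 * B₃ * εk1) * Real.exp (-(τ * D))
      ≤ B₃ * (44 * d ^ 2 * B₃ * εk1) * Real.exp (-(δ * L * M₂ * R1)) :=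
    mul_le_mul (mul_le_mul_of_nonneg_right hCB hm0) hexp (Real.exp_nonneg _) (mul_nonneg hB₃ hm0)
  calc bout.loc y HB ≤ B₃ * (44 * d ^ 2 * B₃ * εk1) * Real.exp (-(δ * L * M₂ * R1)) := h.trans h2
    _ = B₃ * Real.exp (-(δ * L * M₂ * R1)) * (44 * d ^ 2 * B₃) * εk1 := by ring

/-- **(3.18), SECOND INEQUALITY, p. 268**: *"B₃exp(−δLM₂R_{k+1})44d²B₃ε_{k+1} ≦ 44d²B₃²(1+β₀)exp(−R_k)ε_k"* — from the flow
inequality (2.8) `ε_{k+1} ≤ (1+β₀)ε_k` (`ε_{k+1} ≥ 0`) and `R_k ≤ δLM₂R_{k+1}` (from (2.9) and `M₂` large, `R_le_of_flowIneq29`)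
(`R = R_k`, `R1 = R_{k+1}`). [cite: Balaban1988Convergent, (3.18) p.268, (2.8) p.256] -/
theorem boundH318_second {B₃ δ L M₂ R1 R d εk εk1 β₀ : ℝ} (hε1 : 0 ≤ εk1) (hflow : εk1 ≤ (1 + β₀) * εk)
    (hRR : R ≤ δ * L * M₂ * R1) :
    B₃ * Real.exp (-(δ * L * M₂ * R1)) * (44 * d ^ 2 * B₃) * εk1
      ≤ 44 * d ^ 2 * B₃ ^ 2 * (1 + β₀) * Real.exp (-R) * εk := by
  have hexp : Real.exp (-(δ * L * M₂ * R1)) ≤ Real.exp (-R) := Real.exp_le_exp.mpr (by linarith)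
  have h1 : Real.exp (-(δ * L * M₂ * R1)) * εk1 ≤ Real.exp (-R) * ((1 + β₀) * εk) :=
    mul_le_mul hexp hflow hε1 (Real.exp_nonneg _)
  have hK : 0 ≤ 44 * d ^ 2 * B₃ ^ 2 := by positivity
  have h2 := mul_le_mul_of_nonneg_left h1 hK
  calc B₃ * Real.exp (-(δ * L * M₂ * R1)) * (44 * d ^ 2 * B₃) * εk1
        = 44 * d ^ 2 * B₃ ^ 2 * (Real.exp (-(δ * L * M₂ * R1)) * εk1) := by ring
    _ ≤ 44 * d ^ 2 * B₃ ^ 2 * (Real.exp (-R) * ((1 + β₀) * εk)) := h2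
    _ = 44 * d ^ 2 * B₃ ^ 2 * (1 + β₀) * Real.exp (-R) * εk := by ring

/-- **(2.9) p. 256 ⇒ `R_k ≤ δLM₂R_{k+1}`** (the exponent comparison behind the second "≦" of (3.18)): from r11's typed (2.9)
`B14FlowStep.FlowIneq29 R g L β′ β₀ K` at `(m, n) = (k, k+1)` (*"R_m ≦ L(1 + g_n²β′(n−m))^{β₀}R_n"*) and the clause
`(1 + g²_{k+1}β′)^{β₀} ≤ δM₂` (what *"M₂ sufficiently large"* supplies at this step).
[cite: Balaban1988Convergent, (2.9) p.256] -/
theorem R_le_of_flowIneq29 {Rseq : ℕ → ℕ} {gseq : ℕ → ℝ} {L K k : ℕ} {β' β₀ δ M₂ : ℝ}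
    (h29 : B14FlowStep.FlowIneq29 Rseq gseq L β' β₀ K) (hk : k + 1 ≤ K)
    (hM₂ : (1 + gseq (k + 1) ^ 2 * β') ^ β₀ ≤ δ * M₂) :
    (Rseq k : ℝ) ≤ δ * L * M₂ * Rseq (k + 1) := by
  obtain ⟨-, h⟩ := h29 k (k + 1) (Nat.lt_succ_self k) hk
  have e : (1 + gseq (k + 1) ^ 2 * β' * (((k + 1 : ℕ) : ℝ) - k)) = 1 + gseq (k + 1) ^ 2 * β' := by
    push_cast; ring
  rw [e] at h
  have hLR : 0 ≤ (L : ℝ) * Rseq (k + 1) := by positivity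
  calc (Rseq k : ℝ) ≤ L * (1 + gseq (k + 1) ^ 2 * β') ^ β₀ * Rseq (k + 1) := h
    _ = (1 + gseq (k + 1) ^ 2 * β') ^ β₀ * ((L : ℝ) * Rseq (k + 1)) := by ring
    _ ≤ (δ * M₂) * ((L : ℝ) * Rseq (k + 1)) := mul_le_mul_of_nonneg_right hM₂ hLR
    _ = δ * L * M₂ * Rseq (k + 1) := by ring

/-- **(3.18), BOTH INEQUALITIES FROM (190), (2.8), (2.9)**: `bout.loc y 𝐇B ≤ 44d²B₃²(1+β₀)e^{−R_k}ε_k` — the bound used by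
(3.19) (p29's hypothesis `h318`, up to the dictionary). [cite: Balaban1988Convergent, (3.18) p.268; Balaban1985Variational, (190) p.308] -/
theorem boundH318_of_ineq190_second {T : Type*} {bB : BlockNorm g FB} {bout : BlockNorm g FA}
    {dH : T → FB →ₗ[ℝ] FA} {C δ₀ σ τ c D B₃ δ L M₂ R1 R d εk εk1 β₀ : ℝ}
    (h190 : ∀ t, Ineq190 bB bout (dH t) C δ₀) (hC : 0 ≤ C) (hd : ∀ a b : g.Site, 0 ≤ g.dist a b)
    (hrow : RowSum g σ c) (hτ : 0 ≤ τ) (hστ : σ + τ ≤ δ₀ / 8) (B : FB) (y : g.Site)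
    (hm : ∀ y', bB.loc y' B ≤ 44 * d ^ 2 * B₃ * εk1) (hD : ∀ y', bB.loc y' B ≠ 0 → D ≤ g.dist y y')
    {HB : FA} (hmv : ∀ s : ℝ, (∀ t, bout.loc y (dH t B) ≤ s) → bout.loc y HB ≤ s)
    (hgeom : δ * L * M₂ * R1 ≤ τ * D) (hCB : C * bB.κ * c ≤ B₃) (hB₃ : 0 ≤ B₃)
    (hε1 : 0 ≤ εk1) (hflow : εk1 ≤ (1 + β₀) * εk) (hRR : R ≤ δ * L * M₂ * R1) :
    bout.loc y HB ≤ 44 * d ^ 2 * B₃ ^ 2 * (1 + β₀) * Real.exp (-R) * εk :=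
  (boundH318_of_ineq190 h190 hC hd hrow hτ hστ B y hm hD hmv hgeom hCB hB₃).trans
    (boundH318_second hε1 hflow hRR)

/-! ## §2 [III] (3.19) end-to-end on the lattice model: no `𝐇`-hypothesis left -/

section Lattice

variable {d : ℕ}
-- `𝔸` in `Type` (not `Type*`): `B11SectG.BlockNorm` takes its field space in `Type`.
variable {𝔸 : Type} [NormedRing 𝔸] [NormedAlgebra ℂ 𝔸] [CompleteSpace 𝔸] [NormOneClass 𝔸]

/-- **(3.19), ON THE LATTICE MODEL, FROM [15] (190)**: `boundH318_of_ineq190_second` (the bound on `𝐇_{k+1,□′}` for the block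
size `bout` at the base point `y`) ∘ the dictionary `hdom` (that size dominates `‖𝐇(y′,μ)‖` on `B^k(b₋) ∪ B^k(b₊)`) ∘ p29's
`ineq319_lt_local` (the [12]-mechanism and r11's scalar chain `B14Sect3.ineq319_scalar`): `|V^{(k)}(b)(V^{(k)}_{□′}(b))⁻¹ − 1| < δ_k`
(`ε = ε_k = (A₀/A₁)δ_k`, `εk1 = ε_{k+1}`, `R = R_k`, `R1 = R_{k+1}`, `δk = δ_k`; `δ` is the decay rate of (3.18)).
[cite: Balaban1988Convergent, (3.19) p.268; Balaban1985Variational, (190) p.308] -/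
theorem ineq319_lt_lattice_of_ineq190
    -- [15]'s block-majorant data
    {T : Type*} {bB : BlockNorm g FB} {bout : BlockNorm g (B7Prop1Explicit.Site d → Fin d → 𝔸)}
    {dH : T → FB →ₗ[ℝ] (B7Prop1Explicit.Site d → Fin d → 𝔸)} {C δ₀ σ τ c D : ℝ}
    (h190 : ∀ t, Ineq190 bB bout (dH t) C δ₀) (hC : 0 ≤ C) (hd : ∀ a b : g.Site, 0 ≤ g.dist a b)
    (hrow : RowSum g σ c) (hτ : 0 ≤ τ) (hστ : σ + τ ≤ δ₀ / 8) (B : FB) (y : g.Site)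
    {B₃ δ M₂ R1 R β₀ A₀ A₁ ε εk1 δk : ℝ}
    (hm : ∀ y', bB.loc y' B ≤ 44 * (d : ℝ) ^ 2 * B₃ * εk1) (hD : ∀ y', bB.loc y' B ≠ 0 → D ≤ g.dist y y')
    {Hf : B7Prop1Explicit.Site d → Fin d → 𝔸}
    (hmv : ∀ s : ℝ, (∀ t, bout.loc y (dH t B) ≤ s) → bout.loc y Hf ≤ s)
    -- the lattice data (p29)
    {L : ℕ} (hL : 2 ≤ L) {G : Subgroup 𝔸ˣ} (hG : AvgClosed d L G) {k : ℕ}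
    {U₀ : B7Prop1Explicit.Site d → Fin d → 𝔸ˣ} (hU₀ : ∀ x κ, U₀ x κ ∈ G) {α₀ : ℝ} (hα : 0 < α₀)
    (hα3 : C0 d * α₀ ≤ 1 / 3) (hα4 : 4 * α₀ ≤ c2' d L) (h52 : pdev U₀ < α₀ * (((L : ℝ) ^ k)⁻¹) ^ 2)
    (q : B7Prop1Explicit.Site d) (κ : Fin d)
    (hgeom : δ * L * M₂ * R1 ≤ τ * D) (hCB : C * bB.κ * c ≤ B₃) (hB₃ : 0 ≤ B₃)
    -- (2.8), (2.9)
    (hε1 : 0 ≤ εk1) (hflow : εk1 ≤ (1 + β₀) * ε) (hRR : R ≤ δ * L * M₂ * R1)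
    -- the dictionary
    (hdom : ∀ y' μ, B7Prop1Local.InBox (B7Prop1Local.loK L k q) (B7Prop1Local.bondHiK L k q κ) y' →
      ‖Hf y' μ‖ ≤ bout.loc y Hf)
    -- p29's located inputs
    (hβ₀ : 0 ≤ 1 + β₀) (hε : 0 ≤ ε) (hδk : 0 < δk) (hεδ : ε = A₀ / A₁ * δk)
    (hsmall : Real.exp (4 * (800 * ((d : ℝ) + 1) ^ 2 * ((d : ℝ) + 4)) * α₀)
      * (1 + 8 * (131072 * ((d : ℝ) + 1) ^ 2) * (44 * (d : ℝ) ^ 2 * B₃ ^ 2 * (1 + β₀) * Real.exp (-R) * ε)) ≤ 2)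
    (hc₃ : 2 * (44 * (d : ℝ) ^ 2 * B₃ ^ 2 * (1 + β₀) * Real.exp (-R) * ε) ≤ c3 d L)
    (hsm : 2048 * (d : ℝ) * (44 * (d : ℝ) ^ 2 * B₃ ^ 2 * (1 + β₀) * Real.exp (-R) * ε) ≤ 1)
    (h1 : 128 * (44 * (d : ℝ) ^ 2 * B₃ ^ 2 * (1 + β₀) * Real.exp (-R) * ε) ≤ 1)
    (hgk : (68 * ((d : ℝ) + 1) + 160 * d) * 44 * (d : ℝ) ^ 2 * B₃ ^ 2 * (1 + β₀) * (A₀ / A₁) * Real.exp (-R) < 1)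
    (hL1 : 1 ≤ L) :
    ‖((avgIter L
          (gaugeAct (B7Eq84Concrete.glev L hL1 U₀
              (expCfg (fun z μ => ((Complex.I : ℂ) * ((((L : ℝ) ^ (k + 1))⁻¹ : ℝ) : ℂ)) • Hf z μ)) k 0)⁻¹
            (expCfg (fun z μ => ((Complex.I : ℂ) * ((((L : ℝ) ^ (k + 1))⁻¹ : ℝ) : ℂ)) • Hf z μ) * U₀)) k q κ : 𝔸ˣ) : 𝔸)
        * (((avgIter L U₀ k q κ)⁻¹ : 𝔸ˣ) : 𝔸) - 1‖ < δk := by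
  have hloc := boundH318_of_ineq190_second h190 hC hd hrow hτ hστ B y hm hD hmv hgeom hCB hB₃ hε1 hflow hRR
  have h318 : ∀ y' μ, B7Prop1Local.InBox (B7Prop1Local.loK L k q) (B7Prop1Local.bondHiK L k q κ) y' →
      ‖Hf y' μ‖ ≤ 44 * (d : ℝ) ^ 2 * B₃ ^ 2 * (1 + β₀) * Real.exp (-R) * ε :=
    fun y' μ hy => (hdom y' μ hy).trans hloc
  exact ineq319_lt_local hL hG hU₀ hα hα3 hα4 h52 Hf q κ hβ₀ hε hδk hεδ h318 hsmall hc₃ hsm h1 hgk hL1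

/-- **The restriction of (3.19) from γ** (p. 268 *"< δ_k"*, r11's `B14Sect3.ineq319_scalar` hypothesis `hsmall` / p29's `hgk`):
`(68(d+1)+160d)·44d²B₃²(1+β₀)(A₀/A₁)e^{−R_k} < 1` from (2.5) for `R_k` (`B14.IsRj`, `r ≥ 1`), `0 < g_k ≤ γ`, `log γ⁻² ≥ 1`
(`e^{−R_k} ≤ γ²`), the signs `1 + β₀ ≥ 0`, `A₀/A₁ ≥ 0`, and the explicit clause `(68(d+1)+160d)·44d²B₃²(1+β₀)(A₀/A₁)γ² < 1`
(SMALLNESS.md S-B14.19: `R_k ≥ (log g_k⁻²)^r` beats `A₀/A₁`). [cite: Balaban1988Convergent, (3.19) p.268, (2.5) p.255] -/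
theorem hgk_of_gamma {Lnat r R : ℕ} {γ gk B₃ A₀ A₁ β₀ : ℝ} {d : ℕ} (hr : 1 ≤ r) (hRj : B14.IsRj Lnat r gk R)
    (hg : 0 < gk) (hgγ : gk ≤ γ) (hγe : 1 ≤ Real.log (γ ^ 2)⁻¹) (hβ₀ : 0 ≤ 1 + β₀) (hA : 0 ≤ A₀ / A₁)
    (hγ : (68 * ((d : ℝ) + 1) + 160 * d) * 44 * (d : ℝ) ^ 2 * B₃ ^ 2 * (1 + β₀) * (A₀ / A₁) * γ ^ 2 < 1) :
    (68 * ((d : ℝ) + 1) + 160 * d) * 44 * (d : ℝ) ^ 2 * B₃ ^ 2 * (1 + β₀) * (A₀ / A₁) * Real.exp (-(R : ℝ)) < 1 := by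
  have h1 : Real.exp (-(R : ℝ)) ≤ γ ^ 2 := exp_neg_R_le_gamma_sq hr hRj hg hgγ hγe
  have hK : 0 ≤ (68 * ((d : ℝ) + 1) + 160 * d) * 44 * (d : ℝ) ^ 2 * B₃ ^ 2 * (1 + β₀) * (A₀ / A₁) := by positivity
  exact (mul_le_mul_of_nonneg_left h1 hK).trans_lt hγ

/-- **The located side conditions of p29's `ineq319_lt_local` from γ** (`hsmall`, `hc₃`, `hsm`, `h1`, all on the quantity
`X = 44d²B₃²(1+β₀)e^{−R_k}ε_k`): with `e^{−R_k} ≤ γ²` ((2.5), `r ≥ 1`, `0 < g_k ≤ γ`, `log γ⁻² ≥ 1`), `0 ≤ ε_k ≤ 1` and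
`1 + β₀ ≥ 0`, `X ≤ X_γ := 44d²B₃²(1+β₀)γ²`, so the three explicit clauses `2048d·X_γ ≤ 1`, `2X_γ ≤ c₃(d,L)`,
`exp(4·800(d+1)²(d+4)α₀)(1 + 8·131072(d+1)²X_γ) ≤ 2` (`d ≥ 1`) imply them. [cite: Balaban1988Convergent, (3.19) p.268, (2.5) p.255] -/
theorem located319_of_gamma {d L r R : ℕ} {B₃ β₀ ε γ gk α₀ : ℝ} (hd1 : 1 ≤ d)
    (hr : 1 ≤ r) (hRj : B14.IsRj L r gk R) (hg : 0 < gk) (hgγ : gk ≤ γ) (hγe : 1 ≤ Real.log (γ ^ 2)⁻¹)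
    (hβ₀ : 0 ≤ 1 + β₀) (hε0 : 0 ≤ ε) (hε1 : ε ≤ 1)
    (hsmγ : 2048 * (d : ℝ) * (44 * (d : ℝ) ^ 2 * B₃ ^ 2 * (1 + β₀) * γ ^ 2) ≤ 1)
    (hc₃γ : 2 * (44 * (d : ℝ) ^ 2 * B₃ ^ 2 * (1 + β₀) * γ ^ 2) ≤ c3 d L)
    (hsmallγ : Real.exp (4 * (800 * ((d : ℝ) + 1) ^ 2 * ((d : ℝ) + 4)) * α₀)
      * (1 + 8 * (131072 * ((d : ℝ) + 1) ^ 2) * (44 * (d : ℝ) ^ 2 * B₃ ^ 2 * (1 + β₀) * γ ^ 2)) ≤ 2) :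
    Real.exp (4 * (800 * ((d : ℝ) + 1) ^ 2 * ((d : ℝ) + 4)) * α₀)
      * (1 + 8 * (131072 * ((d : ℝ) + 1) ^ 2)
        * (44 * (d : ℝ) ^ 2 * B₃ ^ 2 * (1 + β₀) * Real.exp (-(R : ℝ)) * ε)) ≤ 2 ∧
    2 * (44 * (d : ℝ) ^ 2 * B₃ ^ 2 * (1 + β₀) * Real.exp (-(R : ℝ)) * ε) ≤ c3 d L ∧
    2048 * (d : ℝ) * (44 * (d : ℝ) ^ 2 * B₃ ^ 2 * (1 + β₀) * Real.exp (-(R : ℝ)) * ε) ≤ 1 ∧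
    128 * (44 * (d : ℝ) ^ 2 * B₃ ^ 2 * (1 + β₀) * Real.exp (-(R : ℝ)) * ε) ≤ 1 := by
  set X := 44 * (d : ℝ) ^ 2 * B₃ ^ 2 * (1 + β₀) * Real.exp (-(R : ℝ)) * ε with hX
  set Xγ := 44 * (d : ℝ) ^ 2 * B₃ ^ 2 * (1 + β₀) * γ ^ 2 with hXγ
  have hX0 : 0 ≤ X := by positivity
  have he : Real.exp (-(R : ℝ)) ≤ γ ^ 2 := exp_neg_R_le_gamma_sq hr hRj hg hgγ hγe
  have hXle : X ≤ Xγ := by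
    have h2 : Real.exp (-(R : ℝ)) * ε ≤ γ ^ 2 * 1 := mul_le_mul he hε1 hε0 (by positivity)
    have hK : 0 ≤ 44 * (d : ℝ) ^ 2 * B₃ ^ 2 * (1 + β₀) := by positivity
    calc X = 44 * (d : ℝ) ^ 2 * B₃ ^ 2 * (1 + β₀) * (Real.exp (-(R : ℝ)) * ε) := by rw [hX]; ring
      _ ≤ 44 * (d : ℝ) ^ 2 * B₃ ^ 2 * (1 + β₀) * (γ ^ 2 * 1) := mul_le_mul_of_nonneg_left h2 hK
      _ = Xγ := by rw [hXγ]; ring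
  have hd' : (1 : ℝ) ≤ d := by exact_mod_cast hd1
  refine ⟨?_, ?_, ?_, ?_⟩
  · have hexp : 0 ≤ Real.exp (4 * (800 * ((d : ℝ) + 1) ^ 2 * ((d : ℝ) + 4)) * α₀) := (Real.exp_pos _).le
    have hin : 1 + 8 * (131072 * ((d : ℝ) + 1) ^ 2) * X ≤ 1 + 8 * (131072 * ((d : ℝ) + 1) ^ 2) * Xγ := by
      have := mul_le_mul_of_nonneg_left hXle (by positivity : (0 : ℝ) ≤ 8 * (131072 * ((d : ℝ) + 1) ^ 2))
      linarith
    exact (mul_le_mul_of_nonneg_left hin hexp).trans hsmallγ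
  · linarith
  · have := mul_le_mul_of_nonneg_left hXle (by positivity : (0 : ℝ) ≤ 2048 * (d : ℝ))
    linarith
  · have h2048 : 128 * X ≤ 2048 * (d : ℝ) * X := by nlinarith
    have := mul_le_mul_of_nonneg_left hXle (by positivity : (0 : ℝ) ≤ 2048 * (d : ℝ))
    linarith

/-- **(3.19), ON THE LATTICE MODEL, FROM [15] (190) AND γ — everything assembled**: as `ineq319_lt_lattice_of_ineq190` with
`R = R_k` a natural number as in (2.5) (`B14.IsRj`, `r ≥ 1`), `0 < g_k ≤ γ`, `log γ⁻² ≥ 1`, and p29's restriction `hgk` and four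
located `s`-conditions replaced by `0 ≤ ε_k ≤ 1`, `d ≥ 1`, `A₀/A₁ ≥ 0` and the four explicit clauses of `hgk_of_gamma` /
`located319_of_gamma` (in γ and the (52)-parameter `α₀`); (2.8) `ε_{k+1} ≤ (1+β₀)ε_k` and `R_k ≤ δLM₂R_{k+1}` ((2.9),
`R_le_of_flowIneq29`) as before. [cite: Balaban1988Convergent, (3.19) p.268, (2.5) p.255] -/
theorem ineq319_lt_lattice_of_ineq190_gamma
    {T : Type*} {bB : BlockNorm g FB} {bout : BlockNorm g (B7Prop1Explicit.Site d → Fin d → 𝔸)}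
    {dH : T → FB →ₗ[ℝ] (B7Prop1Explicit.Site d → Fin d → 𝔸)} {C δ₀ σ τ c D : ℝ}
    (h190 : ∀ t, Ineq190 bB bout (dH t) C δ₀) (hC : 0 ≤ C) (hd : ∀ a b : g.Site, 0 ≤ g.dist a b)
    (hrow : RowSum g σ c) (hτ : 0 ≤ τ) (hστ : σ + τ ≤ δ₀ / 8) (B : FB) (y : g.Site)
    {B₃ δ M₂ R1 β₀ A₀ A₁ ε εk1 δk γ gk : ℝ} {r R : ℕ}
    (hm : ∀ y', bB.loc y' B ≤ 44 * (d : ℝ) ^ 2 * B₃ * εk1) (hD : ∀ y', bB.loc y' B ≠ 0 → D ≤ g.dist y y')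
    {Hf : B7Prop1Explicit.Site d → Fin d → 𝔸}
    (hmv : ∀ s : ℝ, (∀ t, bout.loc y (dH t B) ≤ s) → bout.loc y Hf ≤ s)
    {L : ℕ} (hL : 2 ≤ L) {G : Subgroup 𝔸ˣ} (hG : AvgClosed d L G) {k : ℕ}
    {U₀ : B7Prop1Explicit.Site d → Fin d → 𝔸ˣ} (hU₀ : ∀ x κ, U₀ x κ ∈ G) {α₀ : ℝ} (hα : 0 < α₀)
    (hα3 : C0 d * α₀ ≤ 1 / 3) (hα4 : 4 * α₀ ≤ c2' d L) (h52 : pdev U₀ < α₀ * (((L : ℝ) ^ k)⁻¹) ^ 2)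
    (q : B7Prop1Explicit.Site d) (κ : Fin d)
    (hgeom : δ * L * M₂ * R1 ≤ τ * D) (hCB : C * bB.κ * c ≤ B₃) (hB₃ : 0 ≤ B₃)
    (hεk1 : 0 ≤ εk1) (hflow : εk1 ≤ (1 + β₀) * ε) (hRR : (R : ℝ) ≤ δ * L * M₂ * R1)
    (hdom : ∀ y' μ, B7Prop1Local.InBox (B7Prop1Local.loK L k q) (B7Prop1Local.bondHiK L k q κ) y' →
      ‖Hf y' μ‖ ≤ bout.loc y Hf)
    (hβ₀ : 0 ≤ 1 + β₀) (hε0 : 0 ≤ ε) (hε1 : ε ≤ 1) (hδk : 0 < δk) (hεδ : ε = A₀ / A₁ * δk) (hA : 0 ≤ A₀ / A₁)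
    (hL1 : 1 ≤ L) (hd1 : 1 ≤ d)
    -- γ data
    (hr : 1 ≤ r) (hRj : B14.IsRj L r gk R) (hg : 0 < gk) (hgγ : gk ≤ γ) (hγe : 1 ≤ Real.log (γ ^ 2)⁻¹)
    (hγ : (68 * ((d : ℝ) + 1) + 160 * d) * 44 * (d : ℝ) ^ 2 * B₃ ^ 2 * (1 + β₀) * (A₀ / A₁) * γ ^ 2 < 1)
    (hsmγ : 2048 * (d : ℝ) * (44 * (d : ℝ) ^ 2 * B₃ ^ 2 * (1 + β₀) * γ ^ 2) ≤ 1)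
    (hc₃γ : 2 * (44 * (d : ℝ) ^ 2 * B₃ ^ 2 * (1 + β₀) * γ ^ 2) ≤ c3 d L)
    (hsmallγ : Real.exp (4 * (800 * ((d : ℝ) + 1) ^ 2 * ((d : ℝ) + 4)) * α₀)
      * (1 + 8 * (131072 * ((d : ℝ) + 1) ^ 2) * (44 * (d : ℝ) ^ 2 * B₃ ^ 2 * (1 + β₀) * γ ^ 2)) ≤ 2) :
    ‖((avgIter L
          (gaugeAct (B7Eq84Concrete.glev L hL1 U₀
              (expCfg (fun z μ => ((Complex.I : ℂ) * ((((L : ℝ) ^ (k + 1))⁻¹ : ℝ) : ℂ)) • Hf z μ)) k 0)⁻¹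
            (expCfg (fun z μ => ((Complex.I : ℂ) * ((((L : ℝ) ^ (k + 1))⁻¹ : ℝ) : ℂ)) • Hf z μ) * U₀)) k q κ : 𝔸ˣ) : 𝔸)
        * (((avgIter L U₀ k q κ)⁻¹ : 𝔸ˣ) : 𝔸) - 1‖ < δk := by
  obtain ⟨hsmall, hc₃, hsm, h1⟩ := located319_of_gamma (B₃ := B₃) (α₀ := α₀) hd1 hr hRj hg hgγ hγe hβ₀ hε0 hε1 hsmγ hc₃γ
    hsmallγ
  exact ineq319_lt_lattice_of_ineq190 h190 hC hd hrow hτ hστ B y hm hD hmv hL hG hU₀ hα hα3 hα4 h52 q κ hgeom hCB hB₃ hεk1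
    hflow hRR hdom hβ₀ hε0 hδk hεδ hsmall hc₃ hsm h1 (hgk_of_gamma hr hRj hg hgγ hγe hβ₀ hA hγ) hL1

end Lattice

/-! ## §3 (v1.2) [III] (2.8) BY NAME — the flow letter `ε_{k+1} ≤ (1+β₀)ε_k` of §1/§2 from r11's typed (2.8)

p. 268 uses (2.8) at ONE step: *"Thus, the function 𝐇_{k+1,□′} is bounded by B₃exp(−δLM₂R_{k+1})44d²B₃ε_{k+1} ≦
44d²B₃²(1+β₀)exp(−R_k)ε_k on □′^{∼2}"* — the first member of (2.8) p. 256 *"ε_n ≦ (1+β₀)(n−m)^{1/2}ε_m"* at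
`(m, n) = (k, k+1)`, where `(n−m)^{1/2} = 1` (and (2.9) for the exponents, `R_le_of_flowIneq29` of §1).  §1/§2 carry the
flow step as the letter `hflow`; here it is taken BY NAME from `B14.FlowIneq28 ε g β′ β₀ K` (`B14.lean`, row B14.Eq2.8),
exactly as (2.9) is taken by name in `R_le_of_flowIneq29`, and threaded to the assembled (3.19) of §2.  The first member of
(2.8) is the SIGN-FREE one in β (a theorem of the tree along any RG flow of (I.0.20) given β ≤ β′ and γ-smallness:
`B14FlowStep.flowIneq28a_signfree`).  Theorems only; nothing restated; §1/§2 untouched. -/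

/-- **(2.8) p. 256 AT ONE STEP**: `ε_{k+1} ≤ (1+β₀)ε_k` for `k + 1 ≤ K` — the first member of r11's typed (2.8)
`B14.FlowIneq28 ε g β′ β₀ K` (*"ε_n ≦ (1+β₀)(n−m)^{1/2}ε_m"*) at `(m, n) = (k, k+1)` (`((k+1) − k)^{1/2} = 1`); = the flow
letter `hflow` of `boundH318_second` / `ineq319_lt_lattice_of_ineq190(_gamma)` (p. 268 *"44d²B₃ε_{k+1} ≦ 44d²B₃²(1+β₀)…ε_k"*).
For a general step `m < n ≤ K` the first member is `(h28 m n ‹m < n› ‹n ≤ K›).1` itself.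
[cite: Balaban1988Convergent, (2.8) p.256, (3.18) p.268] -/
theorem eps_succ_le_of_flowIneq28 {ε gseq : ℕ → ℝ} {β' β₀ : ℝ} {K k : ℕ}
    (h28 : B14.FlowIneq28 ε gseq β' β₀ K) (hk : k + 1 ≤ K) :
    ε (k + 1) ≤ (1 + β₀) * ε k := by
  obtain ⟨h, -⟩ := h28 k (k + 1) (Nat.lt_succ_self k) hk
  have e : (((k + 1 : ℕ) : ℝ) - (k : ℕ)) = 1 := by push_cast; ring
  rw [e, Real.sqrt_one, mul_one] at h
  exact h

/-- **(3.18), SECOND INEQUALITY, WITH (2.8) AND (2.9) BY NAME** (p. 268 *"B₃exp(−δLM₂R_{k+1})44d²B₃ε_{k+1} ≦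
44d²B₃²(1+β₀)exp(−R_k)ε_k"*): from r11's typed (2.8) `B14.FlowIneq28 ε g β′ β₀ K` and (2.9)
`B14FlowStep.FlowIneq29 R g L β′ β₀ K` at the step `k → k+1 ≤ K`, the clause `(1 + g²_{k+1}β′)^{β₀} ≤ δM₂` (*"M₂ sufficiently
large"*) and `ε_{k+1} ≥ 0` — `boundH318_second` ∘ `eps_succ_le_of_flowIneq28` ∘ `R_le_of_flowIneq29`.
[cite: Balaban1988Convergent, (3.18) p.268, (2.8)–(2.9) p.256] -/
theorem boundH318_second_byname {ε gseq : ℕ → ℝ} {Rseq : ℕ → ℕ} {L K k : ℕ} {B₃ δ M₂ d β' β₀ : ℝ}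
    (h28 : B14.FlowIneq28 ε gseq β' β₀ K) (h29 : B14FlowStep.FlowIneq29 Rseq gseq L β' β₀ K) (hk : k + 1 ≤ K)
    (hM₂ : (1 + gseq (k + 1) ^ 2 * β') ^ β₀ ≤ δ * M₂) (hε1 : 0 ≤ ε (k + 1)) :
    B₃ * Real.exp (-(δ * L * M₂ * Rseq (k + 1))) * (44 * d ^ 2 * B₃) * ε (k + 1)
      ≤ 44 * d ^ 2 * B₃ ^ 2 * (1 + β₀) * Real.exp (-(Rseq k : ℝ)) * ε k :=
  boundH318_second hε1 (eps_succ_le_of_flowIneq28 h28 hk) (R_le_of_flowIneq29 h29 hk hM₂)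

section LatticeByName

variable {d : ℕ}
variable {𝔸 : Type} [NormedRing 𝔸] [NormedAlgebra ℂ 𝔸] [CompleteSpace 𝔸] [NormOneClass 𝔸]

/-- **(3.19), ON THE LATTICE MODEL, FROM [15] (190) AND γ, WITH (2.5), (2.8), (2.9) BY NAME**: §2's
`ineq319_lt_lattice_of_ineq190_gamma` with its flow letter `hflow : ε_{k+1} ≤ (1+β₀)ε_k` and radii letter
`hRR : R_k ≤ δLM₂R_{k+1}` DERIVED from r11's typed (2.8) `B14.FlowIneq28 ε g β′ β₀ K` (`eps_succ_le_of_flowIneq28`) and (2.9)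
`B14FlowStep.FlowIneq29 R g L β′ β₀ K` (`R_le_of_flowIneq29`) at the step `k → k+1 ≤ K` with the clause
`(1 + g²_{k+1}β′)^{β₀} ≤ δM₂`; (2.5) by name as before (`hRj : B14.IsRj L r g_k R_k`); the sequences `ε`, `g`, `R` are those of
the inductive description ((2.4)–(2.9)), read at `k` and `k+1` (`ε_k = (A₀/A₁)δ_k`).  Every other hypothesis verbatim from §2.
[cite: Balaban1988Convergent, (3.19) p.268, (2.5) p.255, (2.8)–(2.9) p.256; Balaban1985Variational, (190) p.308] -/
theorem ineq319_lt_lattice_of_ineq190_gamma_byname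
    {T : Type*} {bB : BlockNorm g FB} {bout : BlockNorm g (B7Prop1Explicit.Site d → Fin d → 𝔸)}
    {dH : T → FB →ₗ[ℝ] (B7Prop1Explicit.Site d → Fin d → 𝔸)} {C δ₀ σ τ c D : ℝ}
    (h190 : ∀ t, Ineq190 bB bout (dH t) C δ₀) (hC : 0 ≤ C) (hd : ∀ a b : g.Site, 0 ≤ g.dist a b)
    (hrow : RowSum g σ c) (hτ : 0 ≤ τ) (hστ : σ + τ ≤ δ₀ / 8) (B : FB) (y : g.Site)
    {B₃ δ M₂ β' β₀ A₀ A₁ δk γ : ℝ} {ε gseq : ℕ → ℝ} {Rseq : ℕ → ℕ} {r K k : ℕ}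
    (hm : ∀ y', bB.loc y' B ≤ 44 * (d : ℝ) ^ 2 * B₃ * ε (k + 1)) (hD : ∀ y', bB.loc y' B ≠ 0 → D ≤ g.dist y y')
    {Hf : B7Prop1Explicit.Site d → Fin d → 𝔸}
    (hmv : ∀ s : ℝ, (∀ t, bout.loc y (dH t B) ≤ s) → bout.loc y Hf ≤ s)
    {L : ℕ} (hL : 2 ≤ L) {G : Subgroup 𝔸ˣ} (hG : AvgClosed d L G)
    {U₀ : B7Prop1Explicit.Site d → Fin d → 𝔸ˣ} (hU₀ : ∀ x κ, U₀ x κ ∈ G) {α₀ : ℝ} (hα : 0 < α₀)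
    (hα3 : C0 d * α₀ ≤ 1 / 3) (hα4 : 4 * α₀ ≤ c2' d L) (h52 : pdev U₀ < α₀ * (((L : ℝ) ^ k)⁻¹) ^ 2)
    (q : B7Prop1Explicit.Site d) (κ : Fin d)
    (hgeom : δ * L * M₂ * Rseq (k + 1) ≤ τ * D) (hCB : C * bB.κ * c ≤ B₃) (hB₃ : 0 ≤ B₃)
    (hεk1 : 0 ≤ ε (k + 1))
    -- (2.8), (2.9) BY NAME at the step k → k+1 ≤ K, and "M₂ sufficiently large"
    (h28 : B14.FlowIneq28 ε gseq β' β₀ K) (h29 : B14FlowStep.FlowIneq29 Rseq gseq L β' β₀ K) (hk : k + 1 ≤ K)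
    (hM₂ : (1 + gseq (k + 1) ^ 2 * β') ^ β₀ ≤ δ * M₂)
    -- the dictionary
    (hdom : ∀ y' μ, B7Prop1Local.InBox (B7Prop1Local.loK L k q) (B7Prop1Local.bondHiK L k q κ) y' →
      ‖Hf y' μ‖ ≤ bout.loc y Hf)
    (hβ₀ : 0 ≤ 1 + β₀) (hε0 : 0 ≤ ε k) (hε1 : ε k ≤ 1) (hδk : 0 < δk) (hεδ : ε k = A₀ / A₁ * δk) (hA : 0 ≤ A₀ / A₁)
    (hL1 : 1 ≤ L) (hd1 : 1 ≤ d)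
    -- (2.5) BY NAME and the γ data
    (hr : 1 ≤ r) (hRj : B14.IsRj L r (gseq k) (Rseq k)) (hg : 0 < gseq k) (hgγ : gseq k ≤ γ)
    (hγe : 1 ≤ Real.log (γ ^ 2)⁻¹)
    (hγ : (68 * ((d : ℝ) + 1) + 160 * d) * 44 * (d : ℝ) ^ 2 * B₃ ^ 2 * (1 + β₀) * (A₀ / A₁) * γ ^ 2 < 1)
    (hsmγ : 2048 * (d : ℝ) * (44 * (d : ℝ) ^ 2 * B₃ ^ 2 * (1 + β₀) * γ ^ 2) ≤ 1)
    (hc₃γ : 2 * (44 * (d : ℝ) ^ 2 * B₃ ^ 2 * (1 + β₀) * γ ^ 2) ≤ c3 d L)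
    (hsmallγ : Real.exp (4 * (800 * ((d : ℝ) + 1) ^ 2 * ((d : ℝ) + 4)) * α₀)
      * (1 + 8 * (131072 * ((d : ℝ) + 1) ^ 2) * (44 * (d : ℝ) ^ 2 * B₃ ^ 2 * (1 + β₀) * γ ^ 2)) ≤ 2) :
    ‖((avgIter L
          (gaugeAct (B7Eq84Concrete.glev L hL1 U₀
              (expCfg (fun z μ => ((Complex.I : ℂ) * ((((L : ℝ) ^ (k + 1))⁻¹ : ℝ) : ℂ)) • Hf z μ)) k 0)⁻¹
            (expCfg (fun z μ => ((Complex.I : ℂ) * ((((L : ℝ) ^ (k + 1))⁻¹ : ℝ) : ℂ)) • Hf z μ) * U₀)) k q κ : 𝔸ˣ) : 𝔸)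
        * (((avgIter L U₀ k q κ)⁻¹ : 𝔸ˣ) : 𝔸) - 1‖ < δk :=
  ineq319_lt_lattice_of_ineq190_gamma h190 hC hd hrow hτ hστ B y hm hD hmv hL hG hU₀ hα hα3 hα4 h52 q κ hgeom hCB hB₃
    hεk1 (eps_succ_le_of_flowIneq28 h28 hk) (R_le_of_flowIneq29 h29 hk hM₂) hdom hβ₀ hε0 hε1 hδk hεδ hA hL1 hd1 hr hRj hg
    hgγ hγe hγ hsmγ hc₃γ hsmallγ

end LatticeByName

end Literature.MathematicalPhysics.QuantumFieldTheory.Balaban1983to89.B14Ineq319From190
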